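import Mathlib
import Literature.Probability.RandomPlanarGeometry.ImageUnivalent
import Literature.Probability.RandomPlanarGeometry.CaratheodoryHalfPlaneProofs

/-!
# Welding rigidity, IV: a conformal automorphism of a Jordan domain fixing three boundary points

Support file for item `stmt-CriticalPhenomena-4505` (`WeldingRigidity`, route
`SAWWeldingIdentification`): the last step of the classical argument — once the glued map `F`
is known to be a holomorphic bijection of `Ω` (removability of the chord), it is the identity.

`eqOn_id_of_tendsto_three`: let `(D; a, b)` be a Dobrushin domain and `c ∈ ∂D ∖ {a, b}`; a map
`F`, holomorphic and injective on `D` with `F(D) = D`, tending to `a` at `a`, to `b` at `b` and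
to `c` at `c` (within `D`), is the identity on `D`. Proof: conjugate by a chordal uniformiser
`ρ : (ℍₒ; 0, ∞) → (D; a, b)` (`MarkedDomain.exists_isChordalUniformizing_holds`); `F` is a
conformal self-equivalence of `D` (`ConformalEquiv.ofInjOn`, Fritzsche–Grauert I.8.5), so
`M = ρ⁻¹ ∘ F ∘ ρ` is an automorphism of `ℍₒ` with `M → 0` at `0` and `M → ∞` at `∞`
(Carathéodory, `JordanDomain.tendsto_symm_nhds` / `tendsto_symm_cocompact`), hence a dilation
`z ↦ k z` (`ConformalEquiv.exists_eqOn_smul_of_tendsto`); the third fixed boundary point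
`x = ρ⁻¹(c) ≠ 0` forces `k = 1`. All inputs are PROVED in the tree; folklore (Ahlfors 1979,
Ch. 4 §3.4; Pommerenke 1992, Cor. 2.7). No definitions.
-/

noncomputable section

open Set Filter Metric Topology Complex
open UpperHalfPlane (upperHalfPlaneSet)

namespace Summit.CriticalPhenomena.SAWScalingLimit.Theorems.WeldingRigidity

open Literature.Probability.RandomPlanarGeometry
open Literature.Probability.RandomPlanarGeometry.JordanDomain

/-- **A conformal automorphism of a Jordan domain fixing three boundary points is the
identity.** For a Dobrushin domain `(D; a, b)` and `c ∈ ∂D ∖ {a, b}`: if `F` is holomorphic and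
injective on `D`, `F(D) = D`, and `F → a, b, c` at `a, b, c` respectively (within `D`), then
`F = id` on `D`. [cite: PommerenkeBBCM1992, §2.3 Cor. 2.7] -/
theorem eqOn_id_of_tendsto_three (D : DobrushinDomain) {c : ℂ} (hc : c ∈ frontier D.carrier)
    (hca : c ≠ D.pt 0) (hcb : c ≠ D.pt 1) {F : ℂ → ℂ}
    (hFd : DifferentiableOn ℂ F D.carrier) (hFi : InjOn F D.carrier)
    (hFs : F '' D.carrier = D.carrier)
    (ha : Tendsto F (𝓝[D.carrier] (D.pt 0)) (𝓝 (D.pt 0)))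
    (hb : Tendsto F (𝓝[D.carrier] (D.pt 1)) (𝓝 (D.pt 1)))
    (hcc : Tendsto F (𝓝[D.carrier] c) (𝓝 c)) :
    EqOn F id D.carrier := by
  obtain ⟨ρ, hρ⟩ := MarkedDomain.exists_isChordalUniformizing_holds D
  obtain ⟨Ψ, hΨc, hΨeq, hbij, -⟩ :=
    exists_continuousOn_extension_holds D.toJordanDomain (cayley.symm.trans ρ)
  have hinj : InjOn Ψ (closedBall 0 1) := hbij.injOn
  -- the real boundary parameter of `c`
  obtain ⟨x, hx⟩ : ∃ x : ℝ, ρ.HasBoundaryValue x c := by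
    rcases existsUnique_real_or_infty_holds D.toJordanDomain ρ hc with ⟨x, hx, -⟩ | hinf
    · exact ⟨x, hx⟩
    · haveI := neBot_cocompact_inf_principal_upperHalfPlaneSet
      exact absurd (tendsto_nhds_unique hinf hρ.2) hcb
  have hx0 : x ≠ 0 := by
    rintro rfl
    haveI := neBot_nhdsWithin_upperHalfPlaneSet_zero
    rw [ofReal_zero] at hx
    exact hca (tendsto_nhds_unique hx hρ.1)
  -- `F` as a conformal self-equivalence of `D`, conjugated to the half-plane
  have hFmaps : MapsTo F D.carrier D.carrier := fun z hz => hFs ▸ mem_image_of_mem F hz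
  set Fe : ConformalEquiv D.carrier D.carrier := ConformalEquiv.ofInjOn F D.isOpen hFd hFi hFs
    with hFe
  set M : ConformalEquiv upperHalfPlaneSet upperHalfPlaneSet := (ρ.trans Fe).trans ρ.symm with hM
  have hMapply : ∀ z, M z = ρ.symm (F (ρ z)) := fun z => rfl
  -- filters
  have hρ0 : Tendsto ρ (𝓝[upperHalfPlaneSet] 0) (𝓝[D.carrier] (D.pt 0)) :=
    tendsto_nhdsWithin_iff.2 ⟨hρ.1, eventually_nhdsWithin_of_forall fun z hz => ρ.mapsTo hz⟩
  have hρinf : Tendsto ρ (cocompact ℂ ⊓ 𝓟 upperHalfPlaneSet) (𝓝[D.carrier] (D.pt 1)) :=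
    tendsto_nhdsWithin_iff.2 ⟨hρ.2,
      eventually_inf_principal.2 (Eventually.of_forall fun z hz => ρ.mapsTo hz)⟩
  have hρx : Tendsto ρ (𝓝[upperHalfPlaneSet] (x : ℂ)) (𝓝[D.carrier] c) :=
    tendsto_nhdsWithin_iff.2 ⟨hx, eventually_nhdsWithin_of_forall fun z hz => ρ.mapsTo hz⟩
  have hFa : Tendsto F (𝓝[D.carrier] (D.pt 0)) (𝓝[D.carrier] (D.pt 0)) :=
    tendsto_nhdsWithin_iff.2 ⟨ha, eventually_nhdsWithin_of_forall hFmaps⟩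
  have hFb : Tendsto F (𝓝[D.carrier] (D.pt 1)) (𝓝[D.carrier] (D.pt 1)) :=
    tendsto_nhdsWithin_iff.2 ⟨hb, eventually_nhdsWithin_of_forall hFmaps⟩
  have hFc : Tendsto F (𝓝[D.carrier] c) (𝓝[D.carrier] c) :=
    tendsto_nhdsWithin_iff.2 ⟨hcc, eventually_nhdsWithin_of_forall hFmaps⟩
  -- `M → 0` at `0`, `M → ∞` at `∞`: `M` is a dilation
  have h0 : Tendsto M (𝓝[upperHalfPlaneSet] 0) (𝓝 0) := by
    have h := (tendsto_symm_nhds ρ hΨc hΨeq hinj (x := 0) (a := D.pt 0)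
      (by exact_mod_cast hρ.1)).comp (hFa.comp hρ0)
    rw [ofReal_zero] at h
    exact h
  have hinf' : Tendsto M (cocompact ℂ ⊓ 𝓟 upperHalfPlaneSet) (cocompact ℂ) :=
    (tendsto_symm_cocompact ρ hΨc hΨeq hinj hρ.2).comp (hFb.comp hρinf)
  obtain ⟨k, -, hMk⟩ := M.exists_eqOn_smul_of_tendsto h0 hinf'
  -- the third fixed point forces `k = 1`
  have hMx : Tendsto M (𝓝[upperHalfPlaneSet] (x : ℂ)) (𝓝 (x : ℂ)) :=
    (tendsto_symm_nhds ρ hΨc hΨeq hinj hx).comp (hFc.comp hρx)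
  have hkx : Tendsto M (𝓝[upperHalfPlaneSet] (x : ℂ)) (𝓝 ((k : ℂ) * x)) := by
    have h1 : Tendsto (fun z : ℂ => (k : ℂ) * z) (𝓝[upperHalfPlaneSet] (x : ℂ))
        (𝓝 ((k : ℂ) * x)) :=
      ((continuous_const.mul continuous_id).tendsto _).mono_left nhdsWithin_le_nhds
    exact h1.congr' (eventually_nhdsWithin_of_forall fun z hz => (hMk hz).symm)
  haveI : NeBot (𝓝[upperHalfPlaneSet] (x : ℂ)) :=
    mem_closure_iff_nhdsWithin_neBot.1 (mem_closure_upperHalfPlaneSet_iff.2 (by simp))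
  have hk1 : (k : ℂ) = 1 := by
    have h := tendsto_nhds_unique hkx hMx
    have hx' : (x : ℂ) ≠ 0 := by exact_mod_cast hx0
    have h2 : ((k : ℂ) - 1) * x = 0 := by rw [sub_mul, one_mul, h, sub_self]
    rcases mul_eq_zero.1 h2 with h3 | h3
    · exact sub_eq_zero.1 h3
    · exact absurd h3 hx'
  -- conclude: `M = id` on `ℍₒ`, so `F = id` on `D`
  intro w hw
  have hz : ρ.symm w ∈ upperHalfPlaneSet := ρ.symm_mapsTo hw
  have h1 : M (ρ.symm w) = ρ.symm w := by
    rw [hMk hz]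
    show (k : ℂ) * ρ.symm w = ρ.symm w
    rw [hk1, one_mul]
  rw [hMapply, ρ.apply_symm_apply hw] at h1
  have h2 := congrArg ρ h1
  rw [ρ.apply_symm_apply (hFmaps hw), ρ.apply_symm_apply hw] at h2
  exact h2

end Summit.CriticalPhenomena.SAWScalingLimit.Theorems.WeldingRigidity
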